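import Summits.HodgeConjecture.HodgeConjecture.Theorems.Ring2WeilCoverageCMFieldRationalClassesFibres
import HarnessLib

/-!
# Ring 2 — Weil-family coverage, CM-field rows: the DYADIC place of `F` lies in no rational class of a biquadratic
  table — completing «which rows `W_{2k}.E.T` have a rational member» (WEIL-FAMILY-COVERAGE «## b03», cell (xxi⁶), part 39)

research route conditional on HC_CM; not a corollary; Q11.4-sentence-2 already refuted in dim ≥ 3.

Parts 33–38 showed, for the Galois quartic CM fields of the census, that a rational class `c ∈ ℚ^×` has its label
`T(c) = {𝔭 : (c, θ)_𝔭 = -1}` constant on the fibres of `Spec 𝓞_F → Spec ℤ` over the odd primes and disjoint from the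
odd ramified-in-`F` and odd inert radicand places.  The one finite place left is the (unique) DYADIC place `v₂` of `F`.
Here, for the quadratic carriers `R = S² + pS + q` with INTEGER radicand (`θ = c₁²·b₀`, `b₀ ∈ ℤ`: the fifteen
biquadratic fields) and ONE dyadic place:

* §111 **`v₂ ∉ T(ℓ)` for every rational prime `ℓ`** whose odd radicand places are harmless (part 12's hypothesis):
  by Hilbert reciprocity `v₂ ∈ T(ℓ) ⟺ #(T(ℓ) ∖ {v₂})` is odd (part 6); but `T(ℓ) ∖ {v₂}` consists of odd places
  `w ∋ ℓ`, `w ∤ b₀`, with `b₀` a non-square mod `w` — so `N w = ℓ` (at norm `ℓ²` every integer is a square, part 13),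
  `(ℓ) = w·J` with `N J = ℓ`, `J` a second prime `w' ≠ w` over `ℓ` (else `(ℓ) = w²` and `ord_w ℓ` is even), `w' ∈ T(ℓ)`
  by part 33's saturation, and a third place over `ℓ` would divide `(ℓ) = w·w'` — hence `T(ℓ) ∖ {v₂} ∈ {∅, {w, w'}}`
  has EVEN cardinality [cite: Omeara1963, §71D Thm. 71:18 and §63B Example 63:12];
* §112 **`v₂ ∉ T(c)` for every POSITIVE rational `c`** once `v₂ ∉ T(ℓ)` for all primes `ℓ`: `T(1) = ∅`,
  `T(xy) = T(x) ∆ T(y)`, `T(x⁻¹) = T(x)` (tree `badPlaces_mul`, `badPlaces_inv`) and induction on the prime factorisations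
  of numerator and denominator (`Nat.recOnMul`) [cite: Deligne1982HodgeCycles, §4 (1)].

With parts 33–38 this gives, for `c > 0` and EVERY finite place `v` of a biquadratic carrier: `v ∈ T(c)` iff `v` is odd,
`v ∤ b₀`, `b₀` is a non-square mod `v` and `ord_v c` is odd — i.e. `T(c)` is the union of the full fibres over the odd
primes `ℓ ∤ b₀` split in `F` with `(b₀|ℓ) = -1` and `ord_ℓ c` odd; the rational rows of the table are EXACTLY the finite
unions of such fibres (instances in the sequel).  No new definition, no named fact, no sorry; nothing about the Hodge
conjecture is asserted.
-/

noncomputable section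

set_option linter.dupNamespace false

open Polynomial NumberField IsDedekindDomain

namespace Summit.HodgeConjecture.HodgeConjecture.Ring2.WeilCoverageCM

open Literature.AlgebraicGeometry.Deligne1982
open Literature.AlgebraicGeometry.HodgeTheory (splitDiscriminantClassCM)
open Literature.NumberTheory.QuadraticForms

variable {R : Polynomial ℤ} [Fact (Irreducible (cmPolyQ R))] [Fact (Irreducible (realPolyQ R))]

/-! ### §111 The dyadic place lies in no `T(ℓ)`, `ℓ` a rational prime (integer radicand, one dyadic place) -/

/-- **THE DYADIC PLACE OF `F` LIES IN NO `T(ℓ)`.** Let `R = S² + pS + q` with real roots, `θ = c₁²·b₀` with `b₀ ∈ ℤ`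
(`E = F(√b₀)` biquadratic), `F` with exactly one dyadic place `v₂`, and `ℓ` a rational prime such that every odd place
`v ∣ b₀` is prime to `ℓ` with `ℓ` a square mod `v` or `ord_v b₀` even (part 12's hypothesis). Then `v₂ ∉ T(ℓ)`:
`T(ℓ) ∖ {v₂}` is `∅` or the full fibre `{w, w'}` over `ℓ` (two places of norm `ℓ`), of even cardinality, while
`v₂ ∈ T(ℓ)` would make it odd (Hilbert reciprocity). [cite: Omeara1963, §71D Thm. 71:18 and §63B Example 63:12]
[cite: Deligne1982HodgeCycles, §4 (1) and Cor. 4.2] -/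
theorem inl_notMem_badPlaces_natCast_of_dyadic {p q : ℤ} (hR : R = X ^ 2 + C p * X + C q)
    (hroots : ∀ s : ℂ, Polynomial.eval₂ (Int.castRingHom ℂ) s R = 0 → s.im = 0 ∧ s.re < 0)
    {c₁ : realField R} {b₀ : ℤ}
    (hfac : AdjoinRoot.root (realPolyQ R) = c₁ ^ 2 * ((b₀ : 𝓞 (realField R)) : realField R))
    (huniq : ∀ v v' : HeightOneSpectrum (𝓞 (realField R)),
      (2 : 𝓞 (realField R)) ∈ v.asIdeal → (2 : 𝓞 (realField R)) ∈ v'.asIdeal → v = v')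
    {ℓ : ℕ} (hℓ : ℓ.Prime)
    (hb : ∀ v : HeightOneSpectrum (𝓞 (realField R)), (2 : 𝓞 (realField R)) ∉ v.asIdeal →
      (b₀ : 𝓞 (realField R)) ∈ v.asIdeal →
      (ℓ : 𝓞 (realField R)) ∉ v.asIdeal ∧
        (IsSquare (Ideal.Quotient.mk v.asIdeal (ℓ : 𝓞 (realField R))) ∨
          ¬ Odd (WithZero.log (v.valuation (realField R) ((b₀ : 𝓞 (realField R)) : realField R)))))
    (v₂ : HeightOneSpectrum (𝓞 (realField R))) (h2 : (2 : 𝓞 (realField R)) ∈ v₂.asIdeal) :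
    Sum.inl v₂ ∉ badPlaces (ℓ : realField R) (AdjoinRoot.root (realPolyQ R)) := by
  intro hmem
  have hK := finrank_realField_quadratic hR
  have hℓ0 : (ℓ : realField R) ≠ 0 := by exact_mod_cast hℓ.ne_zero
  -- Hilbert reciprocity: `T(ℓ) ∖ {v₂}` has odd cardinality
  have hpar := (mem_badPlaces_iff_odd_ncard_diff_singleton (R := R) (Units.mk0 (ℓ : realField R) hℓ0)
    (Sum.inl v₂)).1 (by rwa [Units.val_mk0])
  rw [Units.val_mk0] at hpar
  -- every other bad place is an odd finite place `w ∌ b₀` containing `ℓ`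
  have key : ∀ x ∈ badPlaces (ℓ : realField R) (AdjoinRoot.root (realPolyQ R)) \ {Sum.inl v₂},
      ∃ w : HeightOneSpectrum (𝓞 (realField R)), x = Sum.inl w ∧ (2 : 𝓞 (realField R)) ∉ w.asIdeal ∧
        (b₀ : 𝓞 (realField R)) ∉ w.asIdeal ∧ (ℓ : 𝓞 (realField R)) ∈ w.asIdeal := by
    rintro x ⟨hx, hxne⟩
    rcases x with w | w
    · have h2w : (2 : 𝓞 (realField R)) ∉ w.asIdeal := fun h2w ↦
        hxne (by rw [Set.mem_singleton_iff, huniq w v₂ h2w h2])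
      have hbw : (b₀ : 𝓞 (realField R)) ∉ w.asIdeal := fun hbw ↦
        inl_notMem_badPlaces_natCast_of_mem hfac w h2w (hb w h2w hbw).1 (hb w h2w hbw).2 hx
      exact ⟨w, rfl, h2w, hbw, natCast_mem_of_inl_mem_badPlaces hfac w h2w hbw hℓ hx⟩
    · exact absurd hx (inr_notMem_badPlaces_natCast hroots w hℓ)
  -- pick one such place `w`
  have hne : (badPlaces (ℓ : realField R) (AdjoinRoot.root (realPolyQ R)) \ {Sum.inl v₂}).Nonempty := by
    by_contra hempty
    rw [Set.not_nonempty_iff_eq_empty] at hempty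
    rw [hempty, Set.ncard_empty] at hpar
    exact (Nat.not_odd_iff_even.2 (by decide)) hpar
  obtain ⟨x, hx⟩ := hne
  obtain ⟨w, rfl, h2w, hbw, hℓw⟩ := key _ hx
  have hℓ2 : ℓ ≠ 2 := by
    rintro rfl
    exact h2w (by exact_mod_cast hℓw)
  have hℓb : ¬ (ℓ : ℤ) ∣ b₀ := fun h ↦ hbw ((intCast_mem_iff_natCast_dvd hℓ w hℓw b₀).2 h)
  have hwT := (inl_mem_badPlaces_natCast_iff_of_notMem hfac w h2w hbw hℓ).1 hx.1
  -- `N w = ℓ`: at a place of norm `ℓ²` the integer `b₀` would be a square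
  have hNw : Ideal.absNorm w.asIdeal = ℓ := by
    rcases absNorm_eq_or_eq_sq_of_natCast_mem hK w hℓ hℓw with h | h
    · exact h
    · exact absurd (isSquare_intCast_residue_of_absNorm_eq_sq w hℓ h b₀) hwT.1
  -- `(ℓ) = w · J` with `N J = ℓ`: `J` is a second place `w'` over `ℓ`
  obtain ⟨J, hJ⟩ := Ideal.dvd_iff_le.2 ((Ideal.span_singleton_le_iff_mem _).2 hℓw)
  have hNJ : Ideal.absNorm J = ℓ := by
    have h := congrArg Ideal.absNorm hJ
    rw [absNorm_span_natCast, hK, map_mul, hNw] at h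
    have h' : ℓ * Ideal.absNorm J = ℓ * ℓ := by rw [← h]; ring
    exact Nat.eq_of_mul_eq_mul_left hℓ.pos h'
  have hJprime : J.IsPrime := Ideal.isPrime_of_irreducible_absNorm (by rw [hNJ]; exact hℓ)
  have hJne : J ≠ ⊥ := fun h ↦ hℓ.ne_zero (by rw [← hNJ, h, Ideal.absNorm_bot])
  set w' : HeightOneSpectrum (𝓞 (realField R)) := ⟨J, hJprime, hJne⟩ with hw'
  have hℓw' : (ℓ : 𝓞 (realField R)) ∈ w'.asIdeal := by
    have hle : Ideal.span {(ℓ : 𝓞 (realField R))} ≤ J := by rw [hJ]; exact Ideal.mul_le_left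
    exact hle (Ideal.mem_span_singleton_self _)
  have hunit : ¬ IsUnit w.asIdeal := fun hu ↦ w.isPrime.ne_top (Ideal.isUnit_iff.1 hu)
  have hww' : w ≠ w' := by
    intro h
    -- then `(ℓ) = w²` and `ord_w ℓ = 2` is even
    have hJw : J = w.asIdeal := (congrArg HeightOneSpectrum.asIdeal h).symm
    have hsq : Ideal.span {(ℓ : 𝓞 (realField R))} = w.asIdeal ^ 2 := by rw [hJ, hJw, sq]
    have hval : w.intValuation (ℓ : 𝓞 (realField R)) = WithZero.exp (-(2 : ℕ) : ℤ) := by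
      refine intValuation_eq_exp_neg_of_mem_of_notMem w 2 ?_ ?_
      · rw [← hsq]; exact Ideal.mem_span_singleton_self _
      · intro h3
        have hdvd : w.asIdeal ^ 3 ∣ w.asIdeal ^ 2 := by
          rw [← hsq]; exact Ideal.dvd_iff_le.2 ((Ideal.span_singleton_le_iff_mem _).2 h3)
        have := (pow_dvd_pow_iff w.ne_bot hunit).1 hdvd
        omega
    have hlog : WithZero.log (w.valuation (realField R) (ℓ : realField R)) = -2 := by
      rw [show (ℓ : realField R) = algebraMap (𝓞 (realField R)) (realField R) (ℓ : 𝓞 (realField R)) from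
        (map_natCast _ ℓ).symm, HeightOneSpectrum.valuation_of_algebraMap, hval, WithZero.log_exp]
      norm_num
    have hodd := hwT.2
    rw [hlog] at hodd
    exact (Int.not_odd_iff_even.2 ⟨-1, by norm_num⟩) hodd
  -- `w' ∈ T(ℓ)` by saturation (part 33 (A), `c = ℓ`)
  have hx' : Sum.inl w' ∈ badPlaces (ℓ : realField R) (AdjoinRoot.root (realPolyQ R)) := by
    have h := (inl_mem_badPlaces_ratCast_iff_of_intCast_radicand hR hfac hℓ hℓ2 hℓb w w' hℓw hℓw'
      (c := (ℓ : ℚ)) (by exact_mod_cast hℓ.ne_zero)).1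
    rw [Rat.cast_natCast] at h
    exact h hx.1
  have h2ℓ : ¬ (ℓ : ℤ) ∣ 2 := fun h ↦
    hℓ2 ((Nat.prime_dvd_prime_iff_eq hℓ Nat.prime_two).1 (by exact_mod_cast h))
  have h2w' : (2 : 𝓞 (realField R)) ∉ w'.asIdeal := by
    have h := (intCast_mem_iff_natCast_dvd hℓ w' hℓw' 2).not.2 h2ℓ
    rwa [Int.cast_ofNat] at h
  -- `T(ℓ) ∖ {v₂} = {w, w'}`: a third bad place would be a third place over `ℓ`, dividing `(ℓ) = w·w'`
  obtain ⟨hprod, -⟩ := span_natCast_eq_mul_of_ne hK hℓ w w' hww' hℓw hℓw'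
  have hsub : badPlaces (ℓ : realField R) (AdjoinRoot.root (realPolyQ R)) \ {Sum.inl v₂} = {Sum.inl w, Sum.inl w'} := by
    apply Set.Subset.antisymm
    · intro y hy
      obtain ⟨u, rfl, h2u, hbu, hℓu⟩ := key y hy
      have hle : w.asIdeal * w'.asIdeal ≤ u.asIdeal := by
        rw [← hprod]; exact (Ideal.span_singleton_le_iff_mem _).2 hℓu
      rcases u.isPrime.mul_le.1 hle with h | h
      · have hu : u = w := (HeightOneSpectrum.ext (w.isMaximal.eq_of_le u.isPrime.ne_top h)).symm
        rw [hu]; exact Set.mem_insert _ _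
      · have hu : u = w' := (HeightOneSpectrum.ext (w'.isMaximal.eq_of_le u.isPrime.ne_top h)).symm
        rw [hu]; exact Set.mem_insert_of_mem _ (Set.mem_singleton _)
    · intro y hy
      rw [Set.mem_insert_iff, Set.mem_singleton_iff] at hy
      rcases hy with rfl | rfl
      · exact ⟨hx.1, fun h ↦ h2w (by rw [Set.mem_singleton_iff, Sum.inl.injEq] at h; rw [h]; exact h2)⟩
      · exact ⟨hx', fun h ↦ h2w' (by rw [Set.mem_singleton_iff, Sum.inl.injEq] at h; rw [h]; exact h2)⟩
  have hne' : (Sum.inl w : HeightOneSpectrum (𝓞 (realField R)) ⊕ InfinitePlace (realField R)) ≠ Sum.inl w' :=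
    fun h ↦ hww' (Sum.inl_injective h)
  rw [hsub, Set.ncard_pair hne'] at hpar
  exact (Nat.not_odd_iff_even.2 (by decide)) hpar

/-! ### §112 From primes to every positive rational: `T(1) = ∅`, `T(xy) = T(x) ∆ T(y)`, `T(x⁻¹) = T(x)` -/

omit [Fact (Irreducible (cmPolyQ R))] in
/-- `T(1) = ∅`: `(1, t)_𝔭 = 1` at every place. [folklore] -/
theorem badPlaces_one (t : realField R) : badPlaces (1 : realField R) t = ∅ := by
  ext x
  simp only [mem_badPlaces_iff, Set.mem_empty_iff_false, iff_false]
  cases x with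
  | inl v => rw [placeSymbol_inl, map_one, hilbertSymbol_one_left]; decide
  | inr w => rw [placeSymbol_inr, map_one, hilbertSymbol_one_left]; decide

/-- **A place that lies in no `T(ℓ)` (`ℓ` prime) lies in no `T(n)`, `n ≥ 1` an integer** (`T(ab) = T(a) ∆ T(b)`,
induction on the prime factorisation). [cite: Deligne1982HodgeCycles, §4 (1)] [cite: Omeara1963, §63B] -/
theorem notMem_badPlaces_natCast_of_forall_prime (x : HeightOneSpectrum (𝓞 (realField R)) ⊕ InfinitePlace (realField R))
    (hx : ∀ ℓ : ℕ, ℓ.Prime → x ∉ badPlaces (ℓ : realField R) (AdjoinRoot.root (realPolyQ R)))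
    {n : ℕ} (hn : n ≠ 0) : x ∉ badPlaces (n : realField R) (AdjoinRoot.root (realPolyQ R)) := by
  induction n using Nat.recOnMul with
  | zero => exact absurd rfl hn
  | one => rw [Nat.cast_one, badPlaces_one]; exact Set.notMem_empty _
  | prime p hp => exact hx p hp
  | mul a b iha ihb =>
    have ha : a ≠ 0 := fun h ↦ hn (by rw [h, zero_mul])
    have hb : b ≠ 0 := fun h ↦ hn (by rw [h, mul_zero])
    rw [Nat.cast_mul, badPlaces_mul (by exact_mod_cast ha) (by exact_mod_cast hb) root_realPolyQ_ne_zero,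
      Set.mem_symmDiff]
    push Not
    exact ⟨fun h ↦ absurd h (iha ha), fun h ↦ absurd h (ihb hb)⟩

/-- **A place that lies in no `T(ℓ)` (`ℓ` prime) lies in no `T(c)`, `c ∈ ℚ_{>0}`** (`c = num/den`, `T(x⁻¹) = T(x)`).
[cite: Deligne1982HodgeCycles, §4 (1)] [cite: Omeara1963, §63B] -/
theorem notMem_badPlaces_ratCast_of_forall_prime (x : HeightOneSpectrum (𝓞 (realField R)) ⊕ InfinitePlace (realField R))
    (hx : ∀ ℓ : ℕ, ℓ.Prime → x ∉ badPlaces (ℓ : realField R) (AdjoinRoot.root (realPolyQ R)))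
    {c : ℚ} (hc : 0 < c) : x ∉ badPlaces (c : realField R) (AdjoinRoot.root (realPolyQ R)) := by
  have hnum : 0 < c.num := Rat.num_pos.2 hc
  obtain ⟨m, hm⟩ : ∃ m : ℕ, (m : ℤ) = c.num := ⟨c.num.toNat, Int.toNat_of_nonneg hnum.le⟩
  have hm0 : m ≠ 0 := by rintro rfl; rw [Nat.cast_zero] at hm; exact hnum.ne' hm.symm
  have hden : c.den ≠ 0 := c.den_nz
  have hdenF : ((c.den : ℕ) : realField R) ≠ 0 := by exact_mod_cast hden
  have hmF : ((m : ℕ) : realField R) ≠ 0 := by exact_mod_cast hm0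
  have ec : (c : realField R) = (m : realField R) * ((c.den : realField R))⁻¹ := by
    rw [← div_eq_mul_inv, Rat.cast_def, ← hm, Int.cast_natCast]
  have hinv : badPlaces (((c.den : ℕ) : realField R))⁻¹ (AdjoinRoot.root (realPolyQ R)) =
      badPlaces ((c.den : ℕ) : realField R) (AdjoinRoot.root (realPolyQ R)) := by
    have h := badPlaces_inv (R := R) (Units.mk0 ((c.den : ℕ) : realField R) hdenF)
    rwa [Units.val_inv_eq_inv_val, Units.val_mk0] at h
  rw [ec, badPlaces_mul hmF (inv_ne_zero hdenF) root_realPolyQ_ne_zero, hinv, Set.mem_symmDiff]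
  push Not
  exact ⟨fun h ↦ absurd h (notMem_badPlaces_natCast_of_forall_prime x hx hm0),
    fun h ↦ absurd h (notMem_badPlaces_natCast_of_forall_prime x hx hden)⟩

end Summit.HodgeConjecture.HodgeConjecture.Ring2.WeilCoverageCM

end
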